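import Summits.CriticalPhenomena.PercolationContinuityZ3.Theorems.Transplant.SkelNegBParamsKitA
import Summits.CriticalPhenomena.PercolationContinuityZ3.Theorems.Transplant.SkelNegBParamsB
import Summits.CriticalPhenomena.PercolationContinuityZ3.Theorems.Transplant.SkelNegBChoiceAll
import HarnessLib

/-!
# N1 params, chain of record `NegB`, part SlotsR: THE (R)-SIDE SLOT VALUES AT THE APRON KIT's `R′` — the bridge clearance `NegB.bR := D.k + 2·RA' + 1` (= Δ₀, p3-g9's exact
# (R-F2) floor 2026-08-21T15:55:22Z) and zone-index floor `NegB.mbR := max (2·bR + 26) (22·M_u + 58)`, the bridge pair/data AT these values (`MBR/nBR/hBR/ℓBR/vBR`), and the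
# KIT PAIR's oriented objects `NegB.oK/φK` with its clause from `FactsO` / `AtQO` and its piece-links out of the pair slot (the twin of part B §2 for the kit pair of part K)

builds on p205010 (kernel theorem, internal audit signed; external expert review pending) — nothing in this file uses p205010; NOTHING is claimed about
the node `SamePDropOfSkeletonNeg₁` (OPEN).
Status sentence (coordinator 2026-08-20T04:30Z): "θ(p_c) = 0 on ℤ^d, all d ≥ 2 — kernel-verified (Lean 4/Mathlib, standard axioms); internal adversarial
audit SIGNED 2026-08-20 04:29Z; external expert review pending."
Lane `prim-bschramm-*`, seat `prim-bschramm-stmt` (gen 14); helper file (`--supports stmt-CriticalPhenomena-4575 --as helper`); ledger HOME/prim-bschramm-stmt/NEG-PARAMS.md v0.11.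
The box/width slot values `gR/fR`, the pair slot `PR` and the fibre block `SR` are fixed LAST (part Slots), once the residue seats' floor lists under the S1 corridor are final;
until then residue theorems keep hypotheses on `gv/fv/Pv/Sv` (how-to in SkelNegBChoiceAll's docstring).
* §1 `bR`, `mbR`, `bR_eq`, `mbR_floors`; the bridge AT the slot values: `MBR/nBR/hBR/ℓBR/vBR` (abbreviations of part B's `MB/nB/…` at `(mbR, bR)`), `bridgeR_adm`,
  **`RF2_R`** (`bR ≤ n_b`), **`MB_floorsR`** (`2·bR + 26 ≤ M_b`, `22·M_u + 58 ≤ M_b`, `M_kit < M_b`), `ℓBR_ge` (`2·bR + 27 ≤ ℓ_b` from `EqGeom`);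
  §1b `j₀A_ge` (`tanOff apron.ℓs apron.M ≤ j₀A`, p1-g11 17:00:06Z), `le_of_j₀A_le`;
* §2 the kit pair oriented: `oK/φK`, `lip_φK/steps_φK`, **`clauseK_of_factsO`**, `eqNumK_of_eqGeom`, **`ℓKit_ge`** (`22·M_u + 58 ≤ ℓ_kit` — p1's level-side exit floor (L),
  from `M < ℓ`); §3 at `AtQO` of the choices of record: **`clauseK_of_atQOB`**, **`inputsK_of_atQOB`** (given `(M_kit, n_kit) ∈ Pv`), `clauseBR_of_atQOB`,
  `inputsBR_of_atQOB` (given the bridge pair `∈ Pv`).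
[cite: KozmaNitzan2024, §4 Theorem 6 (pp. 25–31): the order of constants; Lemma 10 (pp. 18–21)] [cite: MartineauTassion2017, §3.2 Lemma 3.5]
-/

noncomputable section

open scoped Classical

namespace Summit.CriticalPhenomena.PercolationContinuityZ3.Theorems.Transplant

namespace PlanarSkeletonNeg

namespace NegB

open MeasureTheory Literature.Probability.Percolation Literature.Probability.LatticeModels SimpleGraph
open SkelConc (Consts)
open Skelφ (oriφ trφ)
open Skelφ.StepI (DataN OutO)
open Neg

/-! ## §1 The bridge slot values at `R′ := RA'` -/

section BridgeR

variable (κ : Consts) {V : Type} [Countable V] {G : SimpleGraph V} [G.LocallyFinite] (Φ : PlanarSkeletonNeg G) (t : V)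
  (p : unitInterval) (D : DataN V)

/-- **THE BRIDGE CLEARANCE OF RECORD** `b := Δ₀ := D.k + 2·R′ + 1` at `R′ := RA'` (p3-g9's exact (R-F2) floor, read AFTER the kit block). [this work] -/
def bR : ℕ := D.k + 2 * RA' κ Φ t p D + 1

/-- **THE BRIDGE ZONE-INDEX FLOOR OF RECORD** `mb := max (2Δ₀ + 26) (22·M_u + 58)`. [this work] -/
def mbR : ℕ := max (2 * bR κ Φ t p D + 26) (22 * Mu D + 58)

/-- `bR = D.k + 2·RA' + 1` (by `rfl`) and `D.k ≤ bR`, `2·RA' + 1 ≤ bR`. [folklore] -/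
theorem bR_eq : bR κ Φ t p D = D.k + 2 * RA' κ Φ t p D + 1 ∧ D.k ≤ bR κ Φ t p D ∧ 2 * RA' κ Φ t p D + 1 ≤ bR κ Φ t p D :=
  ⟨rfl, by unfold bR; omega, by unfold bR; omega⟩

/-- `2·bR + 26 ≤ mbR` and `22·M_u + 58 ≤ mbR`. [folklore] -/
theorem mbR_floors : 2 * bR κ Φ t p D + 26 ≤ mbR κ Φ t p D ∧ 22 * Mu D + 58 ≤ mbR κ Φ t p D := ⟨le_max_left _ _, le_max_right _ _⟩

/-- The bridge zone index at the slot values `M_b := MB D mbR`. [this work] -/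
abbrev MBR : ℕ := MB D (mbR κ Φ t p D)

/-- The bridge width at the slot values `n_b := nB D mbR bR`. [this work] -/
abbrev nBR : ℕ := nB D (mbR κ Φ t p D) (bR κ Φ t p D)

/-- The bridge shear at the slot values. [this work] -/
abbrev hBR : ℤ := hB t D (mbR κ Φ t p D) (bR κ Φ t p D)

/-- The bridge half-length at the slot values. [this work] -/
abbrev ℓBR : ℕ := ℓB t D (mbR κ Φ t p D) (bR κ Φ t p D)

/-- The bridge split point at the slot values. [this work] -/
abbrev vBR : ℤ := vB t D (mbR κ Φ t p D) (bR κ Φ t p D)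

/-- **The bridge pair at the slot values is admissible.** [folklore] -/
theorem bridgeR_adm : D.M₀ ≤ (MBR κ Φ t p D, nBR κ Φ t p D).1 ∧ D.n₁ (MBR κ Φ t p D, nBR κ Φ t p D).1 ≤ (MBR κ Φ t p D, nBR κ Φ t p D).2 :=
  bridge_adm D _ _

/-- **(R-F2) at the values**: `bR ≤ n_b`, together with `M_b < n_b` and `M_b + bR + 2 + ρz ≤ n_b`. [folklore] -/
theorem RF2_R : bR κ Φ t p D ≤ nBR κ Φ t p D ∧ MBR κ Φ t p D < nBR κ Φ t p D ∧ MBR κ Φ t p D + bR κ Φ t p D + 2 + ρz D ≤ nBR κ Φ t p D :=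
  ⟨(nB_facts D _ _).2.2.1, (nB_facts D _ _).2.1, (nB_facts D _ _).2.2.2⟩

/-- **The zone-index floors at the values**: `2·bR + 26 ≤ M_b`, `22·M_u + 58 ≤ M_b`, `M_kit < M_b`, `M_u ≤ M_b`. [folklore] -/
theorem MB_floorsR : 2 * bR κ Φ t p D + 26 ≤ MBR κ Φ t p D ∧ 22 * Mu D + 58 ≤ MBR κ Φ t p D ∧ Mkit D < MBR κ Φ t p D ∧ Mu D ≤ MBR κ Φ t p D := by
  have h1 := (MB_facts D (mbR κ Φ t p D)).2.1
  have h2 := mbR_floors κ Φ t p D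
  refine ⟨h2.1.trans h1, h2.2.trans h1, ?_, (MB_facts D _).1⟩
  show Mkit D < MB D (mbR κ Φ t p D)
  unfold Mkit; omega

/-- **The one-stride room at the values**: from the bridge clause (any map `ψ`), `2·bR + 27 ≤ ℓ_b` (p3-g9 15:55:22Z: `ℓ_b ≥ 2Δ₀ + 25` suffices). [folklore] -/
theorem ℓBR_ge (ψ : V → Site 2) (hE : D.EqGeom G ψ t (MBR κ Φ t p D) (nBR κ Φ t p D)) : 2 * bR κ Φ t p D + 27 ≤ ℓBR κ Φ t p D := by
  have h1 := ℓB_ge t D (mbR κ Φ t p D) (bR κ Φ t p D) ψ hE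
  have h2 := (mbR_floors κ Φ t p D).1
  show _ ≤ ℓB t D (mbR κ Φ t p D) (bR κ Φ t p D)
  omega

end BridgeR

/-! ## §1b The first kit level against the apron's clamp (p1-g11 2026-08-21T17:00:06Z) -/

section Levels

variable {V : Type} {G : SimpleGraph V} [G.LocallyFinite] (Φ : PlanarSkeletonNeg G) (t : V) (D : DataN V)

/-- **`tanOff apron.ℓs apron.M ≤ j₀`** (the kit levels start at the tangential clamp `T₀ = D_sh + M`, so `hwide/hdw/hDw` hold on every level `j ∈ [j₀, j₁]` by `levels_wide`).
[folklore] -/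
theorem j₀A_ge (A : ℤ) (r₀ : ℕ) : SkelI.tanOff (apron Φ t D A r₀).ℓs (apron Φ t D A r₀).M ≤ j₀A t D := by
  rw [tanOff_apron]; rfl

/-- The level range by name: `j₀ = T₀`, `j₀ ≤ j → tanOff ℓs M ≤ j`. [folklore] -/
theorem le_of_j₀A_le (A : ℤ) (r₀ : ℕ) {j : ℕ} (hj : j₀A t D ≤ j) : SkelI.tanOff (apron Φ t D A r₀).ℓs (apron Φ t D A r₀).M ≤ j :=
  (j₀A_ge Φ t D A r₀).trans hj

end Levels

/-! ## §2 The kit pair, oriented -/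

section KitO

variable {V : Type} [DecidableEq V] [Countable V] {G : SimpleGraph V} [G.LocallyFinite] (Φ : PlanarSkeletonNeg G) (t : V)
  (D DT : DataN V) (ori : V → ℕ → ℕ → Bool)

/-- **The kit pair's orientation bit** `o_kit := ori t M_kit n_kit` (values at the merged record). [this work] -/
def oK : Bool := ori t (Mkit (D.orient DT ori)) (nKit (D.orient DT ori))

/-- **The planar map the KIT PIECES live in**: `Φ.φ` or its transpose (located stmt-g14 (L3): need not be the long pair's `φL`). [this work] -/
def φK : V → Site 2 := oriφ Φ.φ (oK t D DT ori)

omit [DecidableEq V] [Countable V] in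
/-- `φK` is 1-Lipschitz. [folklore] -/
theorem lip_φK : Skelφ.Lip G (φK Φ t D DT ori) := Skelφ.lip_oriφ Φ.lip _

omit [DecidableEq V] [Countable V] in
/-- `φK` has unit steps. [folklore] -/
theorem steps_φK : Skelφ.Steps G (φK Φ t D DT ori) := Skelφ.steps_oriφ Φ.step _

omit [DecidableEq V] [Countable V] in
/-- **THE KIT PAIR's CLAUSE FROM `FactsO`**: the merged record's geometric clause at `(M_kit, n_kit)` FOR THE ORIENTED MAP `φK`, and `|h_kit| ≤ 10·n_kit`. [this work] -/
theorem clauseK_of_factsO (hR : DT.R = D.R)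
    (hfacts : ∀ M, D.M₀ ≤ M → ∀ n, D.n₁ M ≤ n →
      (ori t M n = true → D.EqGeom G Φ.φ t M n ∧ (D.hgt t M n).natAbs ≤ 10 * n) ∧
      (ori t M n = false → DT.EqGeom G (trφ Φ.φ) t M n ∧ (DT.hgt t M n).natAbs ≤ 10 * n)) :
    (D.orient DT ori).EqGeom G (φK Φ t D DT ori) t (Mkit (D.orient DT ori)) (nKit (D.orient DT ori)) ∧
      (hKit t (D.orient DT ori)).natAbs ≤ 10 * nKit (D.orient DT ori) :=
  Skelφ.StepI.orient_clause_all hR hfacts _ (Mkit_facts _).2.2 _ (nKit_facts _).1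

omit [DecidableEq V] [Countable V] in
/-- **The kit pair's geometric facts unpacked** (ℤ shapes), for ANY map: `M_kit < n_kit`, `M_kit < ℓ_kit`, `|v_kit| ≤ n_kit`, the layer inequality
`(M_kit+1)(n_kit+|h_kit|) ≤ n_kit(ℓ_kit+1)`. [folklore] -/
theorem eqNumK_of_eqGeom (ψ : V → Site 2) (hE : D.EqGeom G ψ t (Mkit D) (nKit D)) :
    Mkit D < nKit D ∧ Mkit D < ℓKit t D ∧ |vKit t D| ≤ (nKit D : ℤ) ∧
      ((Mkit D : ℤ) + 1) * ((nKit D : ℤ) + |hKit t D|) ≤ (nKit D : ℤ) * ((ℓKit t D : ℤ) + 1) :=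
  eqGeom_num_of t D ψ hE

omit [DecidableEq V] [Countable V] in
/-- **p1's level-side exit floor at the kit pair** (`ℓ ≥ 22·M_z + 57`, (L) 2026-08-21T15:35:14Z): `22·M_u + 58 ≤ ℓ_kit`, from `M_kit < ℓ_kit`. [folklore] -/
theorem ℓKit_ge (ψ : V → Site 2) (hE : D.EqGeom G ψ t (Mkit D) (nKit D)) : 22 * Mu D + 58 ≤ ℓKit t D := by
  have h := (eqNumK_of_eqGeom t D ψ hE).2.1
  unfold Mkit at h; omega

end KitO

/-! ## §3 At `AtQO` of the choices of record -/

section AtQ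

variable {κ : Consts} {V : Type} [DecidableEq V] [Countable V] {G : SimpleGraph V} [G.LocallyFinite] {Φ : PlanarSkeletonNeg G} {t : V} {p : unitInterval}
  {hC : Φ.CylSubcritical p} {gv fv : Neg.FSlot} {Pv : PSlot} {Sv : SSlot} {O : OutO V} {q : unitInterval}

/-- **The kit pair's clause (oriented map `φK`, `|h_kit| ≤ 10 n_kit`)** out of `AtQO`. [this work] -/
theorem clauseK_of_atQOB (hAt : (choiceAtOB κ Φ t p Pv gv fv Sv hC).AtQO O q) :
    O.merged.EqGeom G (φK Φ t O.D O.DT O.ori) t (Mkit O.merged) (nKit O.merged) ∧ (hKit t O.merged).natAbs ≤ 10 * nKit O.merged :=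
  clauseK_of_factsO Φ t O.D O.DT O.ori hAt.1.shared.2.2.1 hAt.1.clauses

/-- **THE KIT PAIR's PIECE-LINKS at `q`** (eight inputs for `φK` over the merged record, accuracy `δI`), given that the pair slot lists `(M_kit, n_kit)`. [this work] -/
theorem inputsK_of_atQOB (hAt : (choiceAtOB κ Φ t p Pv gv fv Sv hC).AtQO O q) (hP : (Mkit O.merged, nKit O.merged) ∈ (Pv κ Φ t p O.merged).1)
    (fam : Fin 2) (σ τ : ℤˣ) :
    1 - Neg.δI κ Φ <
      (bondPercolation G q).real (Skelφ.StepI.eventN G (φK Φ t O.D O.DT O.ori) O.merged (t, Mkit O.merged, some (nKit O.merged, fam, σ, τ))) :=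
  inputsExtra_of_atQOB hAt hP fam σ τ

/-- **The bridge clause at the slot values** (map `φB … mbR bR`, `|h_b| ≤ 10 n_b`) out of `AtQO`. [this work] -/
theorem clauseBR_of_atQOB (hAt : (choiceAtOB κ Φ t p Pv gv fv Sv hC).AtQO O q) :
    O.merged.EqGeom G (φB Φ t O.D O.DT O.ori (mbR κ Φ t p O.merged) (bR κ Φ t p O.merged)) t (MBR κ Φ t p O.merged) (nBR κ Φ t p O.merged) ∧
      (hBR κ Φ t p O.merged).natAbs ≤ 10 * nBR κ Φ t p O.merged :=
  clauseB_of_factsO Φ t O.D O.DT O.ori _ _ hAt.1.shared.2.2.1 hAt.1.clauses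

/-- **The bridge pair's piece-links at the slot values**, given that the pair slot lists it. [this work] -/
theorem inputsBR_of_atQOB (hAt : (choiceAtOB κ Φ t p Pv gv fv Sv hC).AtQO O q) (hP : (MBR κ Φ t p O.merged, nBR κ Φ t p O.merged) ∈ (Pv κ Φ t p O.merged).1)
    (fam : Fin 2) (σ τ : ℤˣ) :
    1 - Neg.δI κ Φ <
      (bondPercolation G q).real (Skelφ.StepI.eventN G (φB Φ t O.D O.DT O.ori (mbR κ Φ t p O.merged) (bR κ Φ t p O.merged)) O.merged
        (t, MBR κ Φ t p O.merged, some (nBR κ Φ t p O.merged, fam, σ, τ))) :=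
  inputsExtra_of_atQOB hAt hP fam σ τ

end AtQ

end NegB

end PlanarSkeletonNeg

end Summit.CriticalPhenomena.PercolationContinuityZ3.Theorems.Transplant

end
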